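import Mathlib
import HarnessLib
import Summits.Ventures.LatticeQCDFlow.Exactness.SpectralKernelContinuity
import Summits.Ventures.LatticeQCDFlow.Exactness.KernelCouplingJacobian
import Summits.Ventures.LatticeQCDFlow.Exactness.CabibboMarinariKernel

/-!
# The spectral coupling layer's update is jointly measurable in (link, frozen context); its exactness for `⊗ Haar` reduces to the kernel's own Jacobian and nothing else

HONEST FRAMING: exact (Metropolis-corrected) sampling algorithms for lattice gauge theory;
figures of merit are autocorrelation/cost numbers at stated couplings and volumes; no
continuum-physics claim.

Venture `LatticeQCDFlow` (cell pub-lqcd), topic `Exactness`; FANOUT row 10 (`eng-equiv`, engine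
`latflow.equiv`, `spectral.SUNSpectralCoupling.forward`: loop `W = U S` with frozen staple `S`,
kernel `h(· | context)` whose spline parameters are read from gauge-invariant FROZEN context,
update `U' = h(W) W† U`; `latflow.flows_jax.sun_flow` / `scan_flow`).  NEW WORK of the cell over
`SpectralKernelContinuity.lean` (the kernel is jointly continuous in (parameters, loop)) and
`KernelCouplingJacobian.lean` (file 9: the layer books the kernel's Jacobian at the loop, under a
joint-measurability hypothesis `hψ`) and row 3x's `CabibboMarinariKernel.lean` (second countability
of `Matrix n n ℂ` / `SU(n)`, imported for its instances only); nothing is cited as a fact; no number; no definition is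
introduced.  Printed counterparts, NAMED ONLY: Boyda et al., PRD 103 (2021) 074504 §II.B, §III;
Kanwar et al., PRL 125 (2020) 121601.

## What is typed

* `continuous_kernelUpdate` / `measurable_kernelUpdate` — on any topological group `G`: if the
  kernel family `(y, P) ↦ h y P` is jointly continuous and the staple `y ↦ S y` is continuous,
  the single-link update `(u, y) ↦ h y (u · S y) (u · S y)⁻¹ u` is jointly continuous, hence
  (Borel, `G` second countable) jointly measurable — exactly the hypothesis `hψ` of
  `KernelCouplingJacobian.hasJacobian_kernelCouplingLayer`;
* **`measurable_spectralKernelUpdate_specialUnitaryGroup`** / `…_unitaryGroup` — for the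
  `SU(n)` / `U(n)` spectral kernel: eigenvalue maps `f y` jointly continuous on
  (parameters) × (unimodular torus), `h y` agreeing with the spectral recipe of `f y`, staple
  continuous ⟹ `hψ` holds (via `continuous_spectralKernel_specialUnitaryGroup_param`);
* **`hasJacobian_spectralCouplingLayer_of_kernelJacobian`** — THE REDUCTION: on any finite link
  set with mask `p`, frozen-context staples `S a y` (continuous), frozen-context eigenvalue maps
  `f a y` (jointly continuous on context × torus), kernels `h a y` following their recipe, and a
  jointly continuous density `j a y ≥ 0` with `HasJacobian (Haar SU(n)) (h a y) (j a y)` for each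
  active link and context — the spectral coupling layer `Theory2.coupleFun p …` is exact for
  `⊗ Haar` with Jacobian `Theory2.coupleJac` (product over active links of the kernel densities
  at the loops).  Every measurability / continuity obligation of file 9 is discharged here; what
  remains as a hypothesis is the kernel's own change of variables on one `SU(n)` (the
  Haar–Vandermonde factor of Boyda eq. (19)), and only that.

NOT here: the kernel's Jacobian itself (Weyl integration); any number.
-/

noncomputable section

namespace Summit.Ventures.LatticeQCDFlow.Exactness

open MeasureTheory Matrix Topology
open Literature.MathematicalPhysics.QuantumFieldTheory
open scoped ENNReal

/-- `U(n)` is second countable (a subspace of the second countable `Matrix n n ℂ`; the `SU(n)`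
twin is the instance `secondCountableTopology_specialUnitaryGroup` of `CabibboMarinariKernel`). -/
theorem secondCountableTopology_unitaryGroup (n : Type*) [Fintype n] [DecidableEq n] :
    SecondCountableTopology (Matrix.unitaryGroup n ℂ) :=
  Topology.IsEmbedding.subtypeVal.secondCountableTopology

/-! ## Any topological group: the single-link kernel update is jointly continuous / measurable -/

section Abstract

variable {G : Type*} [Group G] [TopologicalSpace G] [IsTopologicalGroup G]
  {Y : Type*} [TopologicalSpace Y]

/-- **The kernel update is jointly continuous in (link, frozen context).**  If `(y, P) ↦ h y P`
is jointly continuous and `y ↦ S y` is continuous, then so is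
`(u, y) ↦ h y (u S y) (u S y)⁻¹ u`. -/
theorem continuous_kernelUpdate {h : Y → G → G} (hh : Continuous fun q : Y × G => h q.1 q.2)
    {S : Y → G} (hS : Continuous S) :
    Continuous fun q : G × Y => h q.2 (q.1 * S q.2) * (q.1 * S q.2)⁻¹ * q.1 := by
  have hUS : Continuous fun q : G × Y => q.1 * S q.2 := continuous_fst.mul (hS.comp continuous_snd)
  have hh' : Continuous fun q : G × Y => h q.2 (q.1 * S q.2) :=
    hh.comp (continuous_snd.prodMk hUS)
  exact (hh'.mul hUS.inv).mul continuous_fst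

variable [MeasurableSpace G] [BorelSpace G] [SecondCountableTopology G] [MeasurableSpace Y]
  [BorelSpace Y]

/-- **… hence jointly measurable** (Borel structures, `G` second countable) — the hypothesis
`hψ` of `KernelCouplingJacobian.hasJacobian_kernelCouplingLayer`. -/
theorem measurable_kernelUpdate {h : Y → G → G} (hh : Continuous fun q : Y × G => h q.1 q.2)
    {S : Y → G} (hS : Continuous S) :
    Measurable fun q : G × Y => h q.2 (q.1 * S q.2) * (q.1 * S q.2)⁻¹ * q.1 :=
  (continuous_kernelUpdate hh hS).measurable

/-- A jointly continuous density read at the loop is jointly measurable (the hypothesis `hj`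
of file 9). -/
theorem measurable_densityAtLoop {j : Y → G → ℝ} (hj : Continuous fun q : Y × G => j q.1 q.2)
    {S : Y → G} (hS : Continuous S) :
    Measurable fun q : G × Y => j q.2 (q.1 * S q.2) :=
  (hj.comp (continuous_snd.prodMk (continuous_fst.mul (hS.comp continuous_snd)))).measurable

end Abstract

/-! ## The spectral kernel update on `SU(n)` / `U(n)` -/

section Spectral

variable {n : Type*} [Fintype n] [DecidableEq n] {Y : Type*} [TopologicalSpace Y]
  [MeasurableSpace Y] [BorelSpace Y]

/-- **`hψ` for the `SU(n)` spectral kernel.**  Eigenvalue maps `f y` jointly continuous on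
(parameters) × (unimodular torus), kernels `h y` agreeing with the spectral recipe of `f y`,
staple `S` continuous in the parameters ⟹ the single-link spectral update is jointly measurable
in (link, parameters). -/
theorem measurable_spectralKernelUpdate_specialUnitaryGroup {f : Y → (n → ℂ) → (n → ℂ)}
    {h : Y → Matrix.specialUnitaryGroup n ℂ → Matrix.specialUnitaryGroup n ℂ}
    (hf : ContinuousOn (fun q : Y × (n → ℂ) => f q.1 q.2) {q | ∀ i, ‖q.2 i‖ = 1})
    (hagree : ∀ (y : Y) (P : Matrix.specialUnitaryGroup n ℂ) (V : Matrix n n ℂ) (d : n → ℂ),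
      V ∈ Matrix.unitaryGroup n ℂ → (P : Matrix n n ℂ) = V * diagonal d * star V →
        ((h y P : Matrix.specialUnitaryGroup n ℂ) : Matrix n n ℂ) = V * diagonal (f y d) * star V)
    {S : Y → Matrix.specialUnitaryGroup n ℂ} (hS : Continuous S) :
    Measurable fun q : Matrix.specialUnitaryGroup n ℂ × Y =>
      h q.2 (q.1 * S q.2) * (q.1 * S q.2)⁻¹ * q.1 :=
  measurable_kernelUpdate (continuous_spectralKernel_specialUnitaryGroup_param hf hagree) hS

/-- **`hψ` for the `U(n)` spectral kernel.** -/
theorem measurable_spectralKernelUpdate_unitaryGroup {f : Y → (n → ℂ) → (n → ℂ)}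
    {h : Y → Matrix.unitaryGroup n ℂ → Matrix.unitaryGroup n ℂ}
    (hf : ContinuousOn (fun q : Y × (n → ℂ) => f q.1 q.2) {q | ∀ i, ‖q.2 i‖ = 1})
    (hagree : ∀ (y : Y) (P : Matrix.unitaryGroup n ℂ) (V : Matrix n n ℂ) (d : n → ℂ),
      V ∈ Matrix.unitaryGroup n ℂ → (P : Matrix n n ℂ) = V * diagonal d * star V →
        ((h y P : Matrix.unitaryGroup n ℂ) : Matrix n n ℂ) = V * diagonal (f y d) * star V)
    {S : Y → Matrix.unitaryGroup n ℂ} (hS : Continuous S) :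
    Measurable fun q : Matrix.unitaryGroup n ℂ × Y => h q.2 (q.1 * S q.2) * (q.1 * S q.2)⁻¹ * q.1 :=
  haveI : SecondCountableTopology (Matrix.unitaryGroup n ℂ) := secondCountableTopology_unitaryGroup n
  measurable_kernelUpdate (continuous_spectralKernel_unitaryGroup_param hf hagree) hS

end Spectral

/-! ## The reduction: the spectral coupling layer is exact for `⊗ Haar` given only the kernel's Jacobian -/

section Layer

variable {n : Type*} [Fintype n] [DecidableEq n]

/-- **THE REDUCTION (`SU(n)`).**  On a finite link set `ι` with mask `p`, let every active link
`a` carry a staple `S a y` and an eigenvalue map `f a y` read from the FROZEN links `y`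
(`S a` continuous; `(y, d) ↦ f a y d` jointly continuous on context × unimodular torus), a
kernel `h a y : SU(n) → SU(n)` following the spectral recipe of `f a y`, and a density
`j a y ≥ 0`, jointly continuous in `(y, g)`, with `HasJacobian (Haar SU(n)) (h a y) (j a y)` —
the kernel's own change of variables.  Then the spectral coupling layer
`u_a ↦ h a y (u_a S) (u_a S)⁻¹ u_a` (identity on frozen links) is exact for the product Haar
measure with Jacobian `Theory2.coupleJac` = the product over active links of the kernels'
densities AT THE LOOPS: every measurability hypothesis of
`KernelCouplingJacobian.hasJacobian_kernelCouplingLayer` is discharged by continuity. -/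
theorem hasJacobian_spectralCouplingLayer_of_kernelJacobian {ι : Type*} [Fintype ι]
    (p : ι → Prop) [DecidablePred p]
    (S : {i // p i} → ({i // ¬p i} → Matrix.specialUnitaryGroup n ℂ) → Matrix.specialUnitaryGroup n ℂ)
    (hS : ∀ a, Continuous (S a))
    (f : {i // p i} → ({i // ¬p i} → Matrix.specialUnitaryGroup n ℂ) → (n → ℂ) → (n → ℂ))
    (hf : ∀ a, ContinuousOn
      (fun q : ({i // ¬p i} → Matrix.specialUnitaryGroup n ℂ) × (n → ℂ) => f a q.1 q.2)
      {q | ∀ i, ‖q.2 i‖ = 1})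
    (h : {i // p i} → ({i // ¬p i} → Matrix.specialUnitaryGroup n ℂ) →
      Matrix.specialUnitaryGroup n ℂ → Matrix.specialUnitaryGroup n ℂ)
    (hagree : ∀ a y (P : Matrix.specialUnitaryGroup n ℂ) (V : Matrix n n ℂ) (d : n → ℂ),
      V ∈ Matrix.unitaryGroup n ℂ → (P : Matrix n n ℂ) = V * diagonal d * star V →
        ((h a y P : Matrix.specialUnitaryGroup n ℂ) : Matrix n n ℂ) = V * diagonal (f a y d) * star V)
    (j : {i // p i} → ({i // ¬p i} → Matrix.specialUnitaryGroup n ℂ) → Matrix.specialUnitaryGroup n ℂ → ℝ)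
    (hjc : ∀ a, Continuous
      fun q : ({i // ¬p i} → Matrix.specialUnitaryGroup n ℂ) × Matrix.specialUnitaryGroup n ℂ =>
        j a q.1 q.2)
    (hJ : ∀ a y, HasJacobian (haarProbability (Matrix.specialUnitaryGroup n ℂ)) (h a y)
      fun g => ENNReal.ofReal (j a y g))
    (hj0 : ∀ a y g, 0 ≤ j a y g) :
    HasJacobian (Measure.pi fun _ : ι => haarProbability (Matrix.specialUnitaryGroup n ℂ))
      (Theory2.coupleFun p fun a y u => h a y (u * S a y) * (u * S a y)⁻¹ * u)
      fun U => ENNReal.ofReal (Theory2.coupleJac p (fun a y u => j a y (u * S a y)) U) :=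
  hasJacobian_kernelCouplingLayer p S h j
    (fun a => measurable_spectralKernelUpdate_specialUnitaryGroup (hf a) (hagree a) (hS a))
    (fun a => measurable_densityAtLoop (hjc a) (hS a)) hJ hj0

/-- **THE REDUCTION (`U(n)`).** -/
theorem hasJacobian_spectralCouplingLayer_of_kernelJacobian_unitary {ι : Type*} [Fintype ι]
    (p : ι → Prop) [DecidablePred p]
    (S : {i // p i} → ({i // ¬p i} → Matrix.unitaryGroup n ℂ) → Matrix.unitaryGroup n ℂ)
    (hS : ∀ a, Continuous (S a))
    (f : {i // p i} → ({i // ¬p i} → Matrix.unitaryGroup n ℂ) → (n → ℂ) → (n → ℂ))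
    (hf : ∀ a, ContinuousOn
      (fun q : ({i // ¬p i} → Matrix.unitaryGroup n ℂ) × (n → ℂ) => f a q.1 q.2)
      {q | ∀ i, ‖q.2 i‖ = 1})
    (h : {i // p i} → ({i // ¬p i} → Matrix.unitaryGroup n ℂ) →
      Matrix.unitaryGroup n ℂ → Matrix.unitaryGroup n ℂ)
    (hagree : ∀ a y (P : Matrix.unitaryGroup n ℂ) (V : Matrix n n ℂ) (d : n → ℂ),
      V ∈ Matrix.unitaryGroup n ℂ → (P : Matrix n n ℂ) = V * diagonal d * star V →
        ((h a y P : Matrix.unitaryGroup n ℂ) : Matrix n n ℂ) = V * diagonal (f a y d) * star V)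
    (j : {i // p i} → ({i // ¬p i} → Matrix.unitaryGroup n ℂ) → Matrix.unitaryGroup n ℂ → ℝ)
    (hjc : ∀ a, Continuous
      fun q : ({i // ¬p i} → Matrix.unitaryGroup n ℂ) × Matrix.unitaryGroup n ℂ => j a q.1 q.2)
    (hJ : ∀ a y, HasJacobian (haarProbability (Matrix.unitaryGroup n ℂ)) (h a y)
      fun g => ENNReal.ofReal (j a y g))
    (hj0 : ∀ a y g, 0 ≤ j a y g) :
    HasJacobian (Measure.pi fun _ : ι => haarProbability (Matrix.unitaryGroup n ℂ))
      (Theory2.coupleFun p fun a y u => h a y (u * S a y) * (u * S a y)⁻¹ * u)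
      fun U => ENNReal.ofReal (Theory2.coupleJac p (fun a y u => j a y (u * S a y)) U) :=
  haveI : SecondCountableTopology (Matrix.unitaryGroup n ℂ) := secondCountableTopology_unitaryGroup n
  hasJacobian_kernelCouplingLayer p S h j
    (fun a => measurable_spectralKernelUpdate_unitaryGroup (hf a) (hagree a) (hS a))
    (fun a => measurable_densityAtLoop (hjc a) (hS a)) hJ hj0

end Layer

end Summit.Ventures.LatticeQCDFlow.Exactness
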